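import Summits.FinalStateConjecture.FinalStateConjecture.Theorems.ChannelsResolveTameDevelopmentsR.Negative.ExactSchwarzschildT2
import Summits.FinalStateConjecture.FinalStateConjecture.Theorems.SeamedChartsExhaust.Negative.ExactSchwarzschildHorizon
import Literature.Geometry.Lorentzian.KerrRegionIIDiameter
import Literature.Geometry.Lorentzian.CausalityOpennessProofs
import Literature.Geometry.Lorentzian.NoncompactCauchyFutureSet
import Literature.Geometry.Lorentzian.IdealPoints

/-!
# `exteriorOf` at the `N = 1` paradigm is the domain of outer communications, bounded by the
# event horizon; the chronological past of every future-complete null geodesic ray lies in it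
# (census for crux `stmt-FinalStateConjecture-17430`, route `PhotonSphereChannels`; set form of clause (C))

The T2 consequent of the crux settles the region `O = exteriorOf 𝒟 d.charted = J⁺(Σ) ∩ I⁻(d.charted)`
and its clause (C) `RaysStayInClosure 𝒟 O` is, per development, the SET inclusion
`outerRegion 𝒟 ⊆ exteriorOf 𝒟 d.charted` with `outerRegion = J⁺(Σ) ∩ I⁻(future-complete null rays
from Σ)` (lead, `Theorems/PhotonSphereChannelsEndVisibleOuterRegion.lean`). The `N = 1` census so far
(`ExactSchwarzschildT2`) exercised the `O`-shape only on the exterior patch `r₀ = 2M`, where `O` is the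
whole model. Here, on every ingoing Kerr–Schild patch `Kerr.spacetime M a r₀ hM = ({r > max r₀ 0}, g_{M,a},
−g♯dt*)` of a sub-extremal black hole reaching at most down to the Cauchy horizon (`r₋ ≤ max r₀ 0`):

* `Kerr.radius_causalCurve_le_of_patch` — along a future causal curve starting in `{r < r₊}` the
  Kerr–Schild radius is non-increasing (the tree's `Kerr.radius_causalCurve_le`, stated there for the
  patch `{r > r₋}` only, on an arbitrary such patch);
* `Kerr.subset_exterior_of_isOpen` — an open set contained in `{r ≥ c}` is contained in `{r > c}`
  (Fermat: `∇r ≠ 0`);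
* `Kerr.chronologicalPast_subset_exterior` — **no escape from the black hole, set form**: the
  chronological past of ANY set contained in `{r ≥ r₊}` lies in the domain of outer communications
  `{r > r₊}` (`I⁻` is open, O'Neill 1983, Lemma 14.3);
* `Kerr.chronologicalPast_completeNullRay_subset_exterior` — on the patch `{r > r₋}` (Boyer–Lindquist
  blocks I ∪ II, the region of the maximal development of Kerr data) the chronological past of every
  future-directed null geodesic defined on a whole parameter ray `(t₀, ∞)` lies in `{r > r₊}`: the
  `N = 1` content of `outerRegion ⊆` d.o.c., i.e. of clause (C) in set form (complementing
  `Kerr.completeNullRay_subset_closure_exterior`: the rays themselves lie in `closure {r > r₊}`);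

and, for the exact Schwarzschild model `SchwModel` of the tree (`a = 0`, patch `{r > r₀}`,
`0 < r₀ ≤ 2M`, `O = {r > 2M}`, identity hole chart on `{r > 2M}`, identity flat chart), for EVERY
admissible patch — in particular the horizon-penetrating ones `r₀ < 2M`:

* `SchwModelT2.chronologicalPast_charted_eq` — `I⁻(d.charted) = {r > 2M} = O`;
* `SchwModelT2.O_eq_exteriorOf_shape` — `O = J⁺(univ) ∩ I⁻(d.charted)` (the `exteriorOf` shape) with no
  hypothesis on `r₀` (the tree's `SchwModel.O_eq_core` needs `r₀ = 2M`);
* `SchwModelT2.t2SpacetimeClauses_decomp'` — all four spacetime-level T2 conjuncts on every patch;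
* `SchwModelT2.closure_O_eq` / `SchwModelT2.zH_mem_frontier_O` / `SchwModelT2.O_ne_univ` — on a
  horizon-penetrating patch the settled region is a PROPER subregion, `closure O = {r ≥ 2M}`, and the
  future event horizon point `zH = (2, 2M, 0, 0)` lies on its frontier;
* `SchwModelT2.exists_N_one_properExterior_t2SpacetimeClauses` — packaged existence statement.

So at the paradigm `exteriorOf` is exactly the future domain of outer communications (black-hole
interior excluded even though the ambient development contains it), the closure in clause (C) is
needed exactly for the horizon, and (C) in the lead's set form holds chart by chart.

References: B. O'Neill, *The geometry of Kerr black holes*, A K Peters 1995, Ch. 2, §2.5 ("no particle or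
photon can escape from region II into region I") and Ch. 4, §4.2–§4.3; B. O'Neill, *Semi-Riemannian geometry*,
Academic Press 1983, Ch. 14, Lemma 14.3 (p. 403); M. Dafermos, I. Rodnianski, arXiv:0811.0354, §5.1;
M. Dafermos, J. Luk, arXiv:1710.01722, Conjecture 1; M. Visser, arXiv:0706.0622, (35).
-/

noncomputable section

open TopologicalSpace Manifold Filter Topology Set Function
open scoped ContDiff Topology ENNReal Manifold RealInnerProductSpace

-- instance search through nested operator types `E4 →L E4 →L E4 →L ℝ` (as in the tree files)
set_option maxSynthPendingDepth 3
-- `Summit.FinalStateConjecture.FinalStateConjecture.…` (summit = sub-problem) is the tree's layout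
set_option linter.dupNamespace false

namespace Summit.FinalStateConjecture.FinalStateConjecture.Theorems.ChannelsResolveTameDevelopmentsR.Negative

open Literature.Geometry.Lorentzian LorentzianMetric

/-! ### No escape from the black hole on a general Kerr–Schild patch -/

namespace Kerr

open Literature.Geometry.Lorentzian.Kerr

variable [Kerr.Facts] {M a r₀ : ℝ} {hM : 0 ≤ M}

/-- **Along a future causal curve of `Kerr.spacetime M a r₀ hM` starting with `r < r₊`, the radius
is non-increasing** — on ANY patch `{r > max r₀ 0}` with `r₋ ≤ max r₀ 0` (sub-extremal Kerr). The
tree's `Kerr.radius_causalCurve_le` is the case `r₀ = r₋`; the proof is the same least-upper-bound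
argument: while `r₋ < r < r₊` the derivative `dr(v) < 0` (`Kerr.radiusGrad_lt_zero_of_isFutureDirected`),
so `r` can never climb back to `r₊`. O'Neill 1995, §2.5. [cite: ONeill1995, §2.5] -/
theorem radius_causalCurve_le_of_patch (h : |a| < M) (hr₀ : rMinus M a ≤ max r₀ 0)
    {γ : ℝ → region a r₀} {t₀ t₁ : ℝ}
    (hγ : (spacetime M a r₀ hM).metric.IsFutureCausalCurveOn
      (spacetime M a r₀ hM).timeOrientation γ (Icc t₀ t₁))
    (h₀ : radius a (γ t₀) < rPlus M a) {t : ℝ} (ht : t ∈ Icc t₀ t₁) :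
    radius a (γ t) ≤ radius a (γ t₀) := by
  set f : ℝ → ℝ := fun σ ↦ radius a (γ σ) with hf
  have hder : ∀ σ ∈ Icc t₀ t₁, HasDerivAt f
      (radiusGrad a (E4.spatial (γ σ : E4)) (E4.spatial (deriv (fun σ ↦ (γ σ : E4)) σ))) σ :=
    fun σ hσ ↦ hasDerivAt_radius_causalCurve hγ hσ
  have hcont : ContinuousOn f (Icc t₀ t₁) := fun σ hσ ↦ (hder σ hσ).continuousAt.continuousWithinAt
  have hmin : ∀ σ ∈ Icc t₀ t₁, rMinus M a < f σ := fun σ _ ↦ hr₀.trans_lt (γ σ).2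
  -- derivative negative wherever `f < r₊`
  have hneg : ∀ σ ∈ Icc t₀ t₁, f σ < rPlus M a → deriv f σ < 0 := by
    intro σ hσ hlt
    rw [(hder σ hσ).deriv]
    obtain ⟨-, hle, hne, hfd⟩ := causalCurve_velocity hγ hσ
    exact radiusGrad_lt_zero_of_isFutureDirected h (hmin σ hσ) hlt hle hne hfd
  -- antitone on any `[t₀, b] ⊆ [t₀, t₁]` on which `f < r₊` away from `b`
  have hanti : ∀ b ∈ Icc t₀ t₁, (∀ σ ∈ Ico t₀ b, f σ < rPlus M a) → AntitoneOn f (Icc t₀ b) := by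
    intro b hb hlt
    have hsub : Icc t₀ b ⊆ Icc t₀ t₁ := Icc_subset_Icc le_rfl hb.2
    refine antitoneOn_of_deriv_nonpos (convex_Icc t₀ b) (hcont.mono hsub) ?_ ?_
    · rw [interior_Icc]
      exact fun σ hσ ↦ ((hder σ (hsub (Ioo_subset_Icc_self hσ))).differentiableAt).differentiableWithinAt
    · rw [interior_Icc]
      exact fun σ hσ ↦ (hneg σ (hsub (Ioo_subset_Icc_self hσ)) (hlt σ ⟨hσ.1.le, hσ.2⟩)).le
  -- `f < r₊` on the whole interval
  have hlt : ∀ σ ∈ Icc t₀ t₁, f σ < rPlus M a := by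
    by_contra hcon
    push Not at hcon
    obtain ⟨σ₁, hσ₁, hge⟩ := hcon
    set B : Set ℝ := Icc t₀ t₁ ∩ f ⁻¹' Ici (rPlus M a) with hB
    have hBcl : IsClosed B := hcont.preimage_isClosed_of_isClosed isClosed_Icc isClosed_Ici
    have hBne : B.Nonempty := ⟨σ₁, hσ₁, hge⟩
    have hBbdd : BddBelow B := ⟨t₀, fun σ hσ ↦ hσ.1.1⟩
    set b := sInf B with hb
    have hbB : b ∈ B := hBcl.csInf_mem hBne hBbdd
    have hbI : b ∈ Icc t₀ t₁ := hbB.1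
    have hfb : rPlus M a ≤ f b := hbB.2
    have hbelow : ∀ σ ∈ Ico t₀ b, f σ < rPlus M a := by
      intro σ hσ
      by_contra hσ'
      push Not at hσ'
      have hσB : σ ∈ B := ⟨⟨hσ.1, hσ.2.le.trans hbI.2⟩, hσ'⟩
      exact (lt_irrefl σ) (hσ.2.trans_le (csInf_le hBbdd hσB))
    have hmono := hanti b hbI hbelow
    have : f b ≤ f t₀ := hmono (left_mem_Icc.2 hbI.1) (right_mem_Icc.2 hbI.1) hbI.1
    exact (lt_irrefl (rPlus M a)) (hfb.trans_lt (this.trans_lt h₀))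
  have hmono := hanti t₁ ⟨ht.1.trans ht.2, le_rfl⟩ fun σ hσ ↦ hlt σ ⟨hσ.1, hσ.2.le⟩
  exact hmono (left_mem_Icc.2 (ht.1.trans ht.2)) ht ht.1

omit [Kerr.Facts] in
/-- **An open subset of a Kerr–Schild patch contained in `{r ≥ c}` is contained in `{r > c}`**: at a
point of the open set with `r = c` the radius would have a local minimum on `E4`, so `dr = 0` there
(Fermat), whereas `dr(0, ∇_E r) = |∇_E r|² = (r² + a²)/Σ > 0`. Visser arXiv:0706.0622, (35).
[cite: arXiv07060622, (35)] -/
theorem subset_exterior_of_isOpen {c : ℝ} {U : Set (region a r₀)} (hU : IsOpen U)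
    (hle : U ⊆ {x | c ≤ radius a (x : E4)}) : U ⊆ {x | c < radius a (x : E4)} := by
  intro x hx
  refine (show c ≤ radius a (x : E4) from hle hx).lt_of_ne fun heq ↦ ?_
  have hxr : 0 < radius a (x : E4) := radius_pos_of_mem_region x.2
  -- `x` is a local minimum of `r` on `E4`
  have hmin : IsLocalMin (radius a) (x : E4) := by
    have hopen : IsOpen (Subtype.val '' U) := (region a r₀).isOpen.isOpenMap_subtype_val U hU
    show ∀ᶠ y in 𝓝 (x : E4), radius a (x : E4) ≤ radius a y
    filter_upwards [hopen.mem_nhds (mem_image_of_mem _ hx)] with y hy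
    obtain ⟨y', hy', rfl⟩ := hy
    rw [← heq]
    exact hle hy'
  have h0 := hmin.hasFDerivAt_eq_zero (hasFDerivAt_radius hxr)
  -- evaluate the vanishing differential at `(0, ∇_E r)`
  have hxr' : 0 < radius a (E4.ofTimeSpace 0 (E4.spatial (x : E4))) := by
    rwa [radius_ofTimeSpace_spatial]
  have hpos : 0 < radiusGrad a (E4.spatial (x : E4)) (radiusGradVec a (E4.spatial (x : E4))) := by
    rw [radiusGrad_apply, inner_radiusGradVec_self hxr']
    exact div_pos (by positivity) (blSigma_pos hxr')
  have h1 := congrArg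
    (fun L : E4 →L[ℝ] ℝ ↦ L (E4.ofTimeSpace 0 (radiusGradVec a (E4.spatial (x : E4))))) h0
  simp only [ContinuousLinearMap.comp_apply, E4.spatial_ofTimeSpace, zero_apply] at h1
  exact hpos.ne' h1

/-- **No escape from the black hole, set form.** On a Kerr–Schild patch `{r > max r₀ 0}` with
`r₋ ≤ max r₀ 0` of a sub-extremal Kerr black hole, the chronological past of any set `S ⊆ {r ≥ r₊}`
lies in the domain of outer communications `{r > r₊}`: a point `x ∈ I⁻(S)` is joined to some `s ∈ S`
by a future timelike curve, so `r(x) < r₊` would force `r(s) ≤ r(x) < r₊`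
(`radius_causalCurve_le_of_patch`); hence `I⁻(S) ⊆ {r ≥ r₊}`, and `I⁻(S)` is open (O'Neill 1983,
Lemma 14.3, `isOpen_chronologicalPast_of_boundaryless`), so `subset_exterior_of_isOpen` applies. In
particular `I⁻({r > r₊}) = I⁻({r ≥ r₊}) ⊆ {r > r₊}`: neither the black-hole region nor the event
horizon lies in the past of the exterior. O'Neill 1995, §2.5; O'Neill 1983, Ch. 14, Lemma 14.3.
[cite: ONeill1995, §2.5] [cite: ONeillSemiRiemannian1983, Ch. 14, Lemma 14.3 (p. 403)] -/
theorem chronologicalPast_subset_exterior (h : |a| < M) (hr₀ : rMinus M a ≤ max r₀ 0)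
    {S : Set (spacetime M a r₀ hM).carrier} (hS : S ⊆ {x | rPlus M a ≤ radius a x.1}) :
    (spacetime M a r₀ hM).metric.chronologicalPast (spacetime M a r₀ hM).timeOrientation S ⊆
      {x : (spacetime M a r₀ hM).carrier | rPlus M a < radius a x.1} := by
  have hopen : IsOpen ((spacetime M a r₀ hM).metric.chronologicalPast
      (spacetime M a r₀ hM).timeOrientation S) :=
    isOpen_chronologicalPast_of_boundaryless _ _ _
  -- first `I⁻(S) ⊆ {r ≥ r₊}` (membership kept over the bundled carrier, so that the structure's
  -- own instances are found by unification), then the Fermat step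
  have hsub : (spacetime M a r₀ hM).metric.chronologicalPast (spacetime M a r₀ hM).timeOrientation S ⊆
      {x : (spacetime M a r₀ hM).carrier | rPlus M a ≤ radius a x.1} := by
    intro x hx
    obtain ⟨s, hs, hsx⟩ := mem_chronologicalPast_iff_exists.mp hx
    obtain ⟨p, hp, γ, t₀, t₁, hlt, hγ, hγ₀, hγ₁⟩ := hsx
    rw [mem_singleton_iff] at hp
    show rPlus M a ≤ radius a x.1
    refine le_of_not_gt fun hxlt ↦ ?_
    have h₀ : radius a (γ t₀).1 < rPlus M a := by rw [hγ₀, hp]; exact hxlt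
    have hle := radius_causalCurve_le_of_patch (hM := hM) (γ := γ) h hr₀ hγ.isFutureCausalCurveOn h₀
      (right_mem_Icc.2 hlt.le)
    rw [hγ₁] at hle
    exact (lt_irrefl (rPlus M a)) ((hS hs).trans_lt (hle.trans_lt h₀))
  exact subset_exterior_of_isOpen (a := a) (r₀ := r₀) hopen hsub

/-- **Clause (C) in set form at the paradigm `N = 1`: the chronological past of a future-complete
null geodesic ray lies in the domain of outer communications.** In the ingoing Kerr–Schild chart
`Kerr.spacetime M a r₋ hM` (blocks I ∪ II) of a sub-extremal Kerr black hole, if `γ` is a geodesic on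
a whole parameter ray `(t₀, ∞)`, null and future-directed at some `t₁ > t₀`, then
`I⁻(γ '' (t₀, ∞)) ⊆ {r > r₊}`: the ray lies in `{r ≥ r₊}` (`Kerr.rPlus_le_radius_of_isGeodesicOn_Ioi`,
nullness and orientation propagating along the geodesic) and `chronologicalPast_subset_exterior`
applies. With `outerRegion = J⁺(Σ) ∩ I⁻(future-complete null rays from Σ)` this is the `N = 1`
content of `outerRegion ⊆ exteriorOf` (the lead's set form of `RaysStayInClosure`), chart by chart.
O'Neill 1995, Ch. 2, §2.5 and Ch. 4, §4.2–§4.3. [cite: ONeill1995, Ch. 4, §4.2–§4.3] -/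
theorem chronologicalPast_completeNullRay_subset_exterior (h : |a| < M) (hM : 0 ≤ M)
    [(spacetime M a (rMinus M a) hM).metric.HasLeviCivita]
    {γ : ℝ → region a (rMinus M a)} {t₀ t₁ : ℝ} (ht₀₁ : t₀ < t₁)
    (hγ : IsGeodesicOn (spacetime M a (rMinus M a) hM).metric.leviCivita γ (Ioi t₀))
    (hN : (spacetime M a (rMinus M a) hM).metric.IsNull (velocity 𝓘(ℝ, E4) γ t₁))
    (hF : (spacetime M a (rMinus M a) hM).timeOrientation.IsFutureDirected
      (velocity 𝓘(ℝ, E4) γ t₁)) :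
    (spacetime M a (rMinus M a) hM).metric.chronologicalPast
        (spacetime M a (rMinus M a) hM).timeOrientation (γ '' Ioi t₀) ⊆
      {x : (spacetime M a (rMinus M a) hM).carrier | rPlus M a < radius a x.1} := by
  refine chronologicalPast_subset_exterior (hM := hM) h (le_max_left _ _) ?_
  rintro _ ⟨t, ht, rfl⟩
  set 𝓚 := spacetime M a (rMinus M a) hM with h𝓚
  -- smoothness of the Levi-Civita connection, for the propagation lemma (as in the tree proof of
  -- `Kerr.rPlus_le_radius_of_isGeodesicOn_Ioi`)
  haveI : Fact ((1 : ℕ∞ω) ≤ ((⊤ : ℕ∞) : WithTop ℕ∞)) := ⟨by exact_mod_cast le_top⟩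
  haveI : CovariantDerivative.ContMDiffCovariantDerivative 𝓚.metric.leviCivita 1 :=
    ⟨𝓚.metric.toPseudoRiemannianMetric.isLocallyContMDiff_leviCivita_holds 1
      (by rw [show ((1 : ℕ∞) : ℕ∞ω) + 1 = 2 by norm_num]; exact WithTop.coe_le_coe.2 le_top)
      univ isOpen_univ⟩
  have hNF := hγ.isNull_and_isFutureDirected_velocity 𝓚.metric 𝓚.timeOrientation isOpen_Ioi
    Set.ordConnected_Ioi ht₀₁ hN hF ht
  exact rPlus_le_radius_of_isGeodesicOn_Ioi h hM ht hγ hNF.1 hNF.2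

/-- The exterior is not in the past of the black hole either way round: combining the two previous
statements, on the Kerr chart `{r > r₋}` both every point of a future-complete null geodesic ray and
every point in the chronological past of such a ray lie in `closure {r > r₊} = {r ≥ r₊}` — the ray
can at worst run along the event horizon. O'Neill 1995, Ch. 4, §4.2–§4.3. [cite: ONeill1995, Ch. 4, §4.2–§4.3] -/
theorem completeNullRay_and_past_subset_closure_exterior (h : |a| < M) (hM : 0 ≤ M)
    [(spacetime M a (rMinus M a) hM).metric.HasLeviCivita]
    {γ : ℝ → region a (rMinus M a)} {t₀ t₁ : ℝ} (ht₀₁ : t₀ < t₁)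
    (hγ : IsGeodesicOn (spacetime M a (rMinus M a) hM).metric.leviCivita γ (Ioi t₀))
    (hN : (spacetime M a (rMinus M a) hM).metric.IsNull (velocity 𝓘(ℝ, E4) γ t₁))
    (hF : (spacetime M a (rMinus M a) hM).timeOrientation.IsFutureDirected
      (velocity 𝓘(ℝ, E4) γ t₁)) :
    γ '' Ioi t₀ ∪ (spacetime M a (rMinus M a) hM).metric.chronologicalPast
        (spacetime M a (rMinus M a) hM).timeOrientation (γ '' Ioi t₀) ⊆
      closure {x : region a (rMinus M a) | rPlus M a < radius a (x : E4)} := by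
  rintro x (⟨t, ht, rfl⟩ | hx)
  · exact completeNullRay_subset_closure_exterior h hM ht₀₁ hγ hN hF t ht
  · exact subset_closure (chronologicalPast_completeNullRay_subset_exterior h hM ht₀₁ hγ hN hF hx)

end Kerr

/-! ### The exact Schwarzschild model on an arbitrary patch: `exteriorOf` is `{r > 2M}` -/

namespace SchwModelT2

open SeamedChartsExhaust.Negative SchwModel

variable (P : SchwModel.Params)

/-- `r₋(M, 0) = 0 ≤ max r₀ 0`: every patch of the model reaches at most down to the (degenerate)
Cauchy horizon of Schwarzschild. [folklore] -/
theorem rMinus_le_patch : Kerr.rMinus P.M 0 ≤ max P.r₀ 0 := by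
  have : Kerr.rMinus P.M 0 = 0 := by
    rw [Kerr.rMinus, sq (0 : ℝ), mul_zero, sub_zero, Real.sqrt_sq P.hM.le, sub_self]
  rw [this]
  exact le_max_right _ _

/-- `|0| < M`: the model is sub-extremal. [folklore] -/
theorem abs_spin_lt : |(0 : ℝ)| < P.M := by rw [abs_zero]; exact P.hM

/-- **The chronological past of the exterior is the exterior**: `I⁻({r > 2M}) ⊆ {r > 2M}` on every
patch `{r > r₀}`, `0 < r₀ ≤ 2M`, of the exact Schwarzschild model (`Kerr.chronologicalPast_subset_exterior`
with `a = 0`, `r₊ = 2M`, `r₋ = 0`). O'Neill 1995, §2.5. [cite: ONeill1995, §2.5] -/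
theorem chronologicalPast_subset_O {S : Set (ST P).carrier} (hS : S ⊆ O P) :
    (ST P).metric.chronologicalPast (ST P).timeOrientation S ⊆ O P := by
  intro x hx
  have hS' : S ⊆ {x : (ST P).carrier | Kerr.rPlus P.M 0 ≤ Kerr.radius 0 x.1} :=
    fun y hy ↦ by
      show Kerr.rPlus P.M 0 ≤ Kerr.radius 0 y.1
      rw [P.rPlus_eq]; exact le_of_lt (hS hy)
  have := Kerr.chronologicalPast_subset_exterior (hM := P.hM.le) (abs_spin_lt P) (rMinus_le_patch P)
    hS' hx
  rw [mem_O, ← P.rPlus_eq]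
  exact this

/-- **`I⁻(d.charted) = O = {r > 2M}`** for the model's decomposition on every patch: the charted late
region lies in `O` (`FinalStateDecomposition.charted_subset`), whose chronological past is `O`
(`chronologicalPast_subset_O`); conversely every point of `O` lies below a charted point
(`SchwModel.mem_chronologicalPast_charted`). [cite: ONeill1995, §2.5] -/
theorem chronologicalPast_charted_eq :
    (ST P).metric.chronologicalPast (ST P).timeOrientation (decomp P).charted = O P :=
  Subset.antisymm (chronologicalPast_subset_O P (decomp P).charted_subset)
    fun x hx ↦ mem_chronologicalPast_charted P x hx

/-- **The `exteriorOf` shape on every patch**: `O = J⁺(univ) ∩ I⁻(d.charted)` with NO hypothesis on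
`r₀` (the tree's `SchwModel.O_eq_core` is the exterior patch `r₀ = 2M`, where `O` is everything). On a
horizon-penetrating patch the black-hole region `{r₀ < r ≤ 2M}` of the ambient development is thus
excluded from the settled region, as intended by `exteriorOf = J⁺(Σ) ∩ I⁻(charts)`.
Dafermos–Luk arXiv:1710.01722, Conjecture 1. [cite: DafermosLuk2017, Conjecture 1] -/
theorem O_eq_exteriorOf_shape :
    O P = (ST P).metric.causalFuture (ST P).timeOrientation univ ∩
      (ST P).metric.chronologicalPast (ST P).timeOrientation (decomp P).charted := by
  rw [chronologicalPast_charted_eq]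
  exact (inter_eq_right.mpr fun x _ ↦ subset_causalFuture _ _ _ (mem_univ x)).symm

/-- **All four spacetime-level conjuncts of the T2 consequent hold in the exact Schwarzschild model on
EVERY patch** (`0 < r₀ ≤ 2M`): sub-extremal holes, the `exteriorOf` shape of `O = {r > 2M}`, honest
exhaustive charts and future orientation (the tree's `t2SpacetimeClauses_decomp` assumed `r₀ = 2M`).
Dafermos–Rodnianski arXiv:0811.0354, §5.1; Dafermos–Luk arXiv:1710.01722, Conj. 1.
[cite: arXiv08110354, §5.1] -/
theorem t2SpacetimeClauses_decomp' :
    (∀ i, Kerr.IsSubextremal ((decomp P).mass i) ((decomp P).spin i)) ∧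
      O P = (ST P).metric.causalFuture (ST P).timeOrientation univ ∩
        (ST P).metric.chronologicalPast (ST P).timeOrientation (decomp P).charted ∧
      HasExhaustiveCharts (decomp P) ∧ IsFutureOriented (decomp P) :=
  ⟨isSubextremal_decomp P, O_eq_exteriorOf_shape P, hasExhaustiveCharts_decomp P,
    isFutureOriented_decomp P⟩

/-- **The closure of the settled region is `{r ≥ 2M}`**: `{r ≥ 2M} ⊆ closure {r > 2M}`
(`Kerr.subset_closure_exterior`) and `{r ≥ 2M}` is closed. So the closure in clause (C) adds exactly
the future event horizon `{r = 2M}` of the patch. [cite: arXiv07060622, (35)] -/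
theorem closure_O_eq : closure (O P) = {x : (ST P).carrier | 2 * P.M ≤ Kerr.radius 0 x.1} := by
  refine Subset.antisymm ?_ (Kerr.subset_closure_exterior 0 P.r₀ (2 * P.M))
  exact closure_minimal (fun x (hx : 2 * P.M < Kerr.radius 0 x.1) ↦ (le_of_lt hx : 2 * P.M ≤ _))
    (isClosed_le continuous_const ((Kerr.continuous_radius 0).comp continuous_subtype_val))

/-- `O = {r > 2M}` is open in the patch. [folklore] -/
theorem isOpen_O : IsOpen (O P) :=
  isOpen_lt continuous_const ((Kerr.continuous_radius 0).comp continuous_subtype_val)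

/-- **The event horizon bounds the settled region**: on a horizon-penetrating patch (`r₀ < 2M`) the
horizon point `zH = (2, 2M, 0, 0)` (`SchwModel.zH`, `r(zH) = 2M`) lies on the frontier of
`O = J⁺(univ) ∩ I⁻(d.charted)`. Dafermos–Rodnianski arXiv:0811.0354, §5.1. [cite: arXiv08110354, §5.1] -/
theorem zH_mem_frontier_O (hr₀ : P.r₀ < 2 * P.M) : zH P hr₀ ∈ frontier (O P) := by
  rw [frontier, (isOpen_O P).interior_eq, closure_O_eq]
  refine ⟨?_, fun h ↦ ?_⟩
  · show 2 * P.M ≤ Kerr.radius 0 (zH P hr₀).1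
    exact (radius_zH P hr₀).ge
  · rw [mem_O, radius_zH] at h
    exact lt_irrefl _ h

/-- On a horizon-penetrating patch the settled region is a proper subregion of the development.
[folklore] -/
theorem O_ne_univ (hr₀ : P.r₀ < 2 * P.M) : O P ≠ univ := fun h ↦ by
  have : zH P hr₀ ∈ O P := h ▸ mem_univ _
  rw [mem_O, radius_zH] at this
  exact lt_irrefl _ this

/-- **The T2 spacetime-level clauses are satisfiable with a hole AND a genuine event horizon**: there
are a spacetime `𝓢`, a PROPER subregion `O ≠ univ` and a `C²` final-state decomposition `d` of `O`
with one sub-extremal hole such that `O = J⁺(univ) ∩ I⁻(d.charted)`, `frontier O` is non-empty (it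
contains an event-horizon point), `HasExhaustiveCharts d` and `IsFutureOriented d` — the horizon-penetrating
Schwarzschild patch `{r > 1}`, `M = 1`, `O = {r > 2}`. Complements `exists_N_one_t2SpacetimeClauses`
(exterior patch, `O = univ`). Dafermos–Rodnianski arXiv:0811.0354, §5.1. [cite: arXiv08110354, §5.1] -/
theorem exists_N_one_properExterior_t2SpacetimeClauses :
    ∃ (𝓢 : Spacetime.{0} 4) (O : Set 𝓢.carrier) (d : FinalStateDecomposition 𝓢 O 2),
      d.N = 1 ∧ O ≠ univ ∧ (frontier O).Nonempty ∧
        (∀ i, Literature.Geometry.Lorentzian.Kerr.IsSubextremal (d.mass i) (d.spin i)) ∧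
        O = 𝓢.metric.causalFuture 𝓢.timeOrientation univ ∩
          𝓢.metric.chronologicalPast 𝓢.timeOrientation d.charted ∧
        HasExhaustiveCharts d ∧ IsFutureOriented d :=
  -- unit-mass parameters of a horizon-penetrating patch: `M = 1`, `r₀ = 1 < 2M`, `R₀ = 100`
  let P₁ : SchwModel.Params := ⟨1, 1, 100, one_pos, one_pos, by norm_num, by norm_num⟩
  have hr₀ : P₁.r₀ < 2 * P₁.M := by show (1 : ℝ) < 2 * 1; norm_num
  ⟨ST P₁, O P₁, decomp P₁, rfl, O_ne_univ P₁ hr₀, ⟨zH P₁ hr₀, zH_mem_frontier_O P₁ hr₀⟩,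
    t2SpacetimeClauses_decomp' P₁⟩

end SchwModelT2

end Summit.FinalStateConjecture.FinalStateConjecture.Theorems.ChannelsResolveTameDevelopmentsR.Negative

end
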